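import Summits.Ventures.LatticeQCDFlow.Scoring.PlaquetteAngleSecondMomentWeakCoupling
import HarnessLib

/-!
# Weak-coupling laws of the exact one-plaquette expectations: `x(1 − I_{n+1}(x)/I_n(x)) → n + ½`

HONEST FRAMING: exact (Metropolis-corrected) sampling algorithms for lattice gauge theory;
figures of merit are autocorrelation/cost numbers at stated couplings and volumes; no
continuum-physics claim.

Venture `LatticeQCDFlow` (cell pub-lqcd), sub-topic `Scoring`; FANOUT row 5 (`s0-sun-a`), GEN-15.
NEW WORK of the cell (placement rule).  The infinite-volume 2-d Wilson plaquettes of the cell's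
reference oracles are Bessel ratios: `⟨cos θ_p⟩_β = I₁(β)/I₀(β)` for `U(1)` and
`⟨½ tr U_p⟩_b = I₂(b)/I₁(b)` for `SU(2)` (`Scoring/OnePlaquetteBessel.lean`; the thermodynamic
limits of the exact torus formulas, `Scoring/U1TorusCharacterFormula.lean`,
`Scoring/SU2TorusPlaquetteLimit.lean`).  The Turán/Amos-type ratio bounds of the tree
(`Literature/Probability/LatticeModels/BesselIRatioBounds.lean`) pin `x(1 − I_{n+1}/I_n)` only
inside `[n, n+1]`; the sharp constant `n + ½` is analytic.  Here it is obtained from the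
second-moment law of `Scoring/PlaquetteAngleSecondMomentWeakCoupling.lean` (`β⟨v²⟩_β → 1`, i.e. the
Gaussian `√π`) and the three-term recurrence:

* `two_mul_one_sub_besselRatio_le_sqMoment` — `2(1 − I₁/I₀) ≤ ⟨v²⟩_β` (`2(1 − cos v) ≤ v²`);
  `besselRatio_le_two_mul_beta_mul_one_sub` — `I₁/I₀ ≤ 2β(1 − I₁/I₀)` (`sin² v ≤ 2(1 − cos v)`,
  `β⟨sin² v⟩ = I₁/I₀`); hence **`(I₁/I₀)/2 ≤ β(1 − I₁(β)/I₀(β)) ≤ ½(1 + 2/β)(1 + K/β²)`** for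
  `β ≥ 2` (`K ≤ 240`), `I₁(β)/I₀(β) → 1` and **`β(1 − I₁(β)/I₀(β)) → ½`**;
* **`tendsto_mul_one_sub_besselI_succ_div`** — `x(1 − I_{n+1}(x)/I_n(x)) → n + ½` as `x → ∞` for
  every `n ∈ ℕ` (induction on `x(1 − I_{n+2}/I_{n+1}) = 2(n+1) − x(1 − I_{n+1}/I_n)/(I_{n+1}/I_n)`);
* the plaquettes: **`tendsto_beta_mul_one_sub_onePlaquetteExpect`** — `β(1 − ⟨cos θ_p⟩_β) → ½`
  (`U(1)`); **`tendsto_beta_mul_one_sub_onePlaquetteExpectSU2`** — `b(1 − ⟨½ tr U_p⟩_b) → 3/2` in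
  the reference-table units `b`, i.e. **`β(1 − I₂(2β)/I₁(2β)) → 3/4`** in theory-2's units
  `β = b/2` (`tendsto_beta_mul_one_sub_su2Plaquette_theory2`) — the leading weak-coupling
  (lattice-perturbation-theory) coefficients of the exact 2-d plaquettes, as theorems.

Elementary given the parents; nothing is cited.  No sampler values.
-/

noncomputable section

open Real MeasureTheory Set Filter Topology intervalIntegral
open Literature.Analysis.FunctionSpaces

namespace Summit.Ventures.LatticeQCDFlow.Scoring

/-! ### 1. The ratio `I₁/I₀` -/

/-- `2(1 − I₁(β)/I₀(β)) ≤ ⟨v²⟩_β` for every real `β` (`2(1 − cos v) ≤ v²`). -/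
theorem two_mul_one_sub_besselRatio_le_sqMoment (β : ℝ) :
    2 * (1 - besselI 1 β / besselI 0 β) ≤
      (∫ v in (-π)..π, v ^ 2 * Real.exp (β * Real.cos v)) /
        (∫ v in (-π)..π, Real.exp (β * Real.cos v)) := by
  have hπ : 0 < π := Real.pi_pos
  have hle : -π ≤ π := by linarith
  have hI0 : 0 < besselI 0 β := besselI_zero_pos β
  have hZ := integral_exp_mul_cos_neg_pi_pi_pos β
  have hc1 : Continuous fun v => 2 * Real.exp (β * Real.cos v) := by fun_prop
  have hc2 : Continuous fun v => 2 * (Real.cos v * Real.exp (β * Real.cos v)) := by fun_prop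
  have hmono : ∫ v in (-π)..π, (2 * Real.exp (β * Real.cos v) -
      2 * (Real.cos v * Real.exp (β * Real.cos v))) ≤
        ∫ v in (-π)..π, v ^ 2 * Real.exp (β * Real.cos v) := by
    refine intervalIntegral.integral_mono_on hle ((hc1.sub hc2).intervalIntegrable _ _) ?_
      fun v _ => ?_
    · exact (by fun_prop : Continuous fun v => v ^ 2 * Real.exp (β * Real.cos v)).intervalIntegrable _ _
    · have h := two_mul_one_sub_cos_le_sq v
      have hw := (Real.exp_pos (β * Real.cos v)).le
      nlinarith [mul_le_mul_of_nonneg_right h hw]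
  rw [intervalIntegral.integral_sub (hc1.intervalIntegrable _ _) (hc2.intervalIntegrable _ _),
    intervalIntegral.integral_const_mul, intervalIntegral.integral_const_mul,
    integral_exp_mul_cos_neg_pi_pi, integral_cos_mul_exp_mul_cos_neg_pi_pi] at hmono
  rw [integral_exp_mul_cos_neg_pi_pi, le_div_iff₀ (by positivity)]
  have e : 2 * (1 - besselI 1 β / besselI 0 β) * (2 * π * besselI 0 β) =
      2 * (2 * π * besselI 0 β) - 2 * (2 * π * besselI 1 β) := by
    field_simp
  rw [e]
  exact hmono

/-- `I₁(β)/I₀(β) ≤ 2β(1 − I₁(β)/I₀(β))` for `β ≥ 0` (`sin² v ≤ 2(1 − cos v)` and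
`β ∫ sin² v w_β = 2π I₁`). -/
theorem besselRatio_le_two_mul_beta_mul_one_sub {β : ℝ} (hβ : 0 ≤ β) :
    besselI 1 β / besselI 0 β ≤ 2 * β * (1 - besselI 1 β / besselI 0 β) := by
  have hπ : 0 < π := Real.pi_pos
  have hle : -π ≤ π := by linarith
  have hI0 : 0 < besselI 0 β := besselI_zero_pos β
  have hc1 : Continuous fun v => 2 * Real.exp (β * Real.cos v) := by fun_prop
  have hc2 : Continuous fun v => 2 * (Real.cos v * Real.exp (β * Real.cos v)) := by fun_prop
  have hmono : ∫ v in (-π)..π, Real.sin v ^ 2 * Real.exp (β * Real.cos v) ≤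
      ∫ v in (-π)..π, (2 * Real.exp (β * Real.cos v) -
        2 * (Real.cos v * Real.exp (β * Real.cos v))) := by
    refine intervalIntegral.integral_mono_on hle ?_ ((hc1.sub hc2).intervalIntegrable _ _)
      fun v _ => ?_
    · exact (by fun_prop : Continuous fun v => Real.sin v ^ 2 * Real.exp (β * Real.cos v))
        |>.intervalIntegrable _ _
    · have h := sin_sq_mul_exp_le β v
      linarith
  rw [intervalIntegral.integral_sub (hc1.intervalIntegrable _ _) (hc2.intervalIntegrable _ _),
    intervalIntegral.integral_const_mul, intervalIntegral.integral_const_mul,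
    integral_exp_mul_cos_neg_pi_pi, integral_cos_mul_exp_mul_cos_neg_pi_pi] at hmono
  have hS := beta_mul_integral_sin_sq_mul_exp β
  have h1 : 2 * π * besselI 1 β ≤ β * (2 * (2 * π * besselI 0 β) - 2 * (2 * π * besselI 1 β)) := by
    have h := mul_le_mul_of_nonneg_left hmono hβ
    rwa [hS] at h
  rw [div_le_iff₀ hI0]
  have e : 2 * β * (1 - besselI 1 β / besselI 0 β) * besselI 0 β =
      2 * β * (besselI 0 β - besselI 1 β) := by
    field_simp
  rw [e]
  nlinarith [h1, hπ]

/-- **Two-sided weak-coupling bound on the `U(1)` plaquette deficit**: for `β ≥ 2`,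
`(I₁/I₀)/2 ≤ β(1 − I₁(β)/I₀(β)) ≤ ½(1 + 2/β)(1 + K/β²)`, `K = (9/10) e^{−3} π⁷ √π ≤ 240`. -/
theorem beta_mul_one_sub_besselRatio_mem_Icc {β : ℝ} (hβ : 2 ≤ β) :
    β * (1 - besselI 1 β / besselI 0 β) ∈
      Icc (besselI 1 β / besselI 0 β / 2)
        (1 / 2 * ((1 + 2 / β) * (1 + 9 / 10 * Real.exp (-3) * π ^ 7 * Real.sqrt π / β ^ 2))) := by
  have hβ0 : 0 < β := by linarith
  constructor
  · have h := besselRatio_le_two_mul_beta_mul_one_sub hβ0.le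
    linarith
  · have h1 := two_mul_one_sub_besselRatio_le_sqMoment β
    have h2 := beta_mul_sqMoment_le hβ
    have h3 := mul_le_mul_of_nonneg_left h1 hβ0.le
    rw [mul_div_assoc] at h2
    linarith

/-- `0 ≤ 1 − I₁(β)/I₀(β)` (`I₁ ≤ I₀`). -/
theorem one_sub_besselRatio_nonneg (β : ℝ) : 0 ≤ 1 - besselI 1 β / besselI 0 β := by
  have := (div_le_one (besselI_zero_pos β)).2 (besselI_le_besselI_zero 1 β)
  linarith

/-- **`I₁(β)/I₀(β) → 1` as `β → ∞`** (the `U(1)` plaquette tends to `1`). -/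
theorem tendsto_besselI_one_div_besselI_zero :
    Tendsto (fun β : ℝ => besselI 1 β / besselI 0 β) atTop (𝓝 1) := by
  set K := 9 / 10 * Real.exp (-3) * π ^ 7 * Real.sqrt π with hK
  -- `0 ≤ 1 − r ≤ (1/(2β))(1 + 2/β)(1 + K/β²) → 0`
  have hinv : Tendsto (fun β : ℝ => β⁻¹) atTop (𝓝 0) := tendsto_inv_atTop_zero
  have hup : Tendsto (fun β : ℝ => β⁻¹ * (1 / 2 * ((1 + 2 / β) * (1 + K / β ^ 2)))) atTop (𝓝 0) := by
    have h1 : Tendsto (fun β : ℝ => 1 + 2 / β) atTop (𝓝 1) := by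
      simpa [div_eq_mul_inv] using (hinv.const_mul 2).const_add 1
    have h2 : Tendsto (fun β : ℝ => 1 + K / β ^ 2) atTop (𝓝 1) := by
      simpa [div_eq_mul_inv, inv_pow] using ((hinv.pow 2).const_mul K).const_add 1
    have h3 := hinv.mul ((h1.mul h2).const_mul (1 / 2))
    rw [show (0 : ℝ) * (1 / 2 * (1 * 1)) = 0 by norm_num] at h3
    exact h3
  have hdiff : Tendsto (fun β : ℝ => 1 - besselI 1 β / besselI 0 β) atTop (𝓝 0) := by
    refine tendsto_of_tendsto_of_tendsto_of_le_of_le' tendsto_const_nhds hup ?_ ?_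
    · exact Eventually.of_forall fun β => one_sub_besselRatio_nonneg β
    · filter_upwards [eventually_ge_atTop (2 : ℝ)] with β hβ
      have hβ0 : 0 < β := by linarith
      have h := (beta_mul_one_sub_besselRatio_mem_Icc hβ).2
      rw [← hK] at h
      calc 1 - besselI 1 β / besselI 0 β = β⁻¹ * (β * (1 - besselI 1 β / besselI 0 β)) := by
            field_simp
        _ ≤ β⁻¹ * (1 / 2 * ((1 + 2 / β) * (1 + K / β ^ 2))) :=
            mul_le_mul_of_nonneg_left h (inv_pos.2 hβ0).le
  have := (tendsto_const_nhds (x := (1 : ℝ))).sub hdiff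
  simpa using this

/-- **`β(1 − I₁(β)/I₀(β)) → ½` as `β → ∞`**: the leading weak-coupling coefficient of the
infinite-volume 2-d `U(1)` plaquette `1 − ⟨cos θ_p⟩_β`. -/
theorem tendsto_beta_mul_one_sub_besselRatio :
    Tendsto (fun β : ℝ => β * (1 - besselI 1 β / besselI 0 β)) atTop (𝓝 (1 / 2)) := by
  set K := 9 / 10 * Real.exp (-3) * π ^ 7 * Real.sqrt π with hK
  have hinv : Tendsto (fun β : ℝ => β⁻¹) atTop (𝓝 0) := tendsto_inv_atTop_zero
  have hlo : Tendsto (fun β : ℝ => besselI 1 β / besselI 0 β / 2) atTop (𝓝 (1 / 2)) := by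
    simpa using tendsto_besselI_one_div_besselI_zero.div_const 2
  have hup : Tendsto (fun β : ℝ => 1 / 2 * ((1 + 2 / β) * (1 + K / β ^ 2))) atTop (𝓝 (1 / 2)) := by
    have h1 : Tendsto (fun β : ℝ => 1 + 2 / β) atTop (𝓝 1) := by
      simpa [div_eq_mul_inv] using (hinv.const_mul 2).const_add 1
    have h2 : Tendsto (fun β : ℝ => 1 + K / β ^ 2) atTop (𝓝 1) := by
      simpa [div_eq_mul_inv, inv_pow] using ((hinv.pow 2).const_mul K).const_add 1
    have h3 := (h1.mul h2).const_mul (1 / 2)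
    rw [show (1 / 2 : ℝ) * (1 * 1) = 1 / 2 by norm_num] at h3
    exact h3
  refine tendsto_of_tendsto_of_tendsto_of_le_of_le' hlo hup ?_ ?_
  · filter_upwards [eventually_ge_atTop (2 : ℝ)] with β hβ using
      (beta_mul_one_sub_besselRatio_mem_Icc hβ).1
  · filter_upwards [eventually_ge_atTop (2 : ℝ)] with β hβ using
      (beta_mul_one_sub_besselRatio_mem_Icc hβ).2

/-! ### 2. All orders, by the three-term recurrence -/

/-- The recurrence in ratio form (`x > 0`):
`x(1 − I_{n+2}(x)/I_{n+1}(x)) = 2(n+1) − x(1 − I_{n+1}(x)/I_n(x))/(I_{n+1}(x)/I_n(x))`. -/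
theorem mul_one_sub_besselI_ratio_succ {x : ℝ} (hx : 0 < x) (n : ℕ) :
    x * (1 - besselI (n + 2) x / besselI (n + 1) x) =
      2 * (n + 1) - x * (1 - besselI (n + 1) x / besselI n x) / (besselI (n + 1) x / besselI n x) := by
  have h := mul_besselI_sub_besselI_add_two n x
  have h0 : 0 < besselI n x := besselI_pos n hx
  have h1 : 0 < besselI (n + 1) x := besselI_pos (n + 1) hx
  field_simp
  linear_combination h

/-- **`x(1 − I_{n+1}(x)/I_n(x)) → n + ½` as `x → ∞`, for every `n ∈ ℕ`.** -/
theorem tendsto_mul_one_sub_besselI_succ_div (n : ℕ) :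
    Tendsto (fun x : ℝ => x * (1 - besselI (n + 1) x / besselI n x)) atTop (𝓝 (n + 1 / 2)) := by
  induction n with
  | zero => simpa using tendsto_beta_mul_one_sub_besselRatio
  | succ n ih =>
    -- the ratio `I_{n+1}/I_n → 1`
    have hr : Tendsto (fun x : ℝ => besselI (n + 1) x / besselI n x) atTop (𝓝 1) := by
      have h0 : Tendsto (fun x : ℝ => x * (1 - besselI (n + 1) x / besselI n x) * x⁻¹) atTop (𝓝 0) := by
        simpa using ih.mul tendsto_inv_atTop_zero
      have h1 : Tendsto (fun x : ℝ => 1 - besselI (n + 1) x / besselI n x) atTop (𝓝 0) := by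
        refine h0.congr' ?_
        filter_upwards [eventually_gt_atTop (0 : ℝ)] with x hx
        field_simp
      simpa using (tendsto_const_nhds (x := (1 : ℝ))).sub h1
    have hlim : Tendsto (fun x : ℝ => 2 * ((n : ℝ) + 1) -
        x * (1 - besselI (n + 1) x / besselI n x) / (besselI (n + 1) x / besselI n x)) atTop
        (𝓝 (2 * ((n : ℝ) + 1) - ((n : ℝ) + 1 / 2) / 1)) :=
      tendsto_const_nhds.sub (ih.div hr one_ne_zero)
    have e : 2 * ((n : ℝ) + 1) - ((n : ℝ) + 1 / 2) / 1 = ((n + 1 : ℕ) : ℝ) + 1 / 2 := by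
      push_cast; ring
    rw [e] at hlim
    refine hlim.congr' ?_
    filter_upwards [eventually_gt_atTop (0 : ℝ)] with x hx
    rw [show n + 1 + 1 = n + 2 by ring]
    exact (mul_one_sub_besselI_ratio_succ hx n).symm

/-! ### 3. The plaquettes -/

/-- **`U(1)`: `β(1 − ⟨cos θ_p⟩_β) → ½`** for the infinite-volume 2-d plaquette
`⟨cos θ⟩_β = onePlaquetteExpect β cos = I₁(β)/I₀(β)` (`Scoring/OnePlaquetteBessel.lean`). -/
theorem tendsto_beta_mul_one_sub_onePlaquetteExpect :
    Tendsto (fun β : ℝ => β * (1 - onePlaquetteExpect β Real.cos)) atTop (𝓝 (1 / 2)) := by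
  simpa only [onePlaquetteExpect_cos_eq_besselI_div] using tendsto_beta_mul_one_sub_besselRatio

/-- **`SU(2)`, reference-table units**: `b(1 − ⟨cos α⟩_b) → 3/2` for the class-angle one-plaquette
law `onePlaquetteExpectSU2 b cos = I₂(b)/I₁(b)` (`= ⟨½ tr U_p⟩` at table coupling `b`). -/
theorem tendsto_beta_mul_one_sub_onePlaquetteExpectSU2 :
    Tendsto (fun b : ℝ => b * (1 - onePlaquetteExpectSU2 b Real.cos)) atTop (𝓝 (3 / 2)) := by
  have h := tendsto_mul_one_sub_besselI_succ_div 1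
  have e : ((1 : ℕ) : ℝ) + 1 / 2 = 3 / 2 := by norm_num
  rw [e] at h
  simpa only [onePlaquetteExpectSU2_cos_eq_besselI_div] using h

/-- **`SU(2)`, theory-2 units** (`b = 2β`; the infinite-volume torus plaquette is `I₂(2β)/I₁(2β)`,
`Scoring/SU2TorusPlaquetteLimit.lean`): **`β(1 − I₂(2β)/I₁(2β)) → 3/4`**. -/
theorem tendsto_beta_mul_one_sub_su2Plaquette_theory2 :
    Tendsto (fun β : ℝ => β * (1 - besselI 2 (2 * β) / besselI 1 (2 * β))) atTop (𝓝 (3 / 4)) := by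
  have h2 : Tendsto (fun β : ℝ => 2 * β) atTop atTop := tendsto_id.const_mul_atTop (by norm_num)
  have h := (tendsto_mul_one_sub_besselI_succ_div 1).comp h2
  have h' : Tendsto (fun β : ℝ => (1 / 2 : ℝ) * (2 * β * (1 - besselI 2 (2 * β) / besselI 1 (2 * β))))
      atTop (𝓝 ((1 / 2 : ℝ) * (((1 : ℕ) : ℝ) + 1 / 2))) := h.const_mul (1 / 2)
  have e : (1 / 2 : ℝ) * (((1 : ℕ) : ℝ) + 1 / 2) = 3 / 4 := by norm_num
  rw [e] at h'
  refine h'.congr' (Eventually.of_forall fun β => ?_)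
  ring

end Summit.Ventures.LatticeQCDFlow.Scoring
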